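import Mathlib.Analysis.Complex.Basic
import Mathlib.Analysis.SpecialFunctions.Pow.Real
import Literature.Computability.Complexity.NullstellensatzRefutation
import HarnessLib

/-!
# The Skoda–Brownawell degree bound: Łojasiewicz exponent at infinity ⇒ Nullstellensatz degree

Topic `Literature/RingTheory/Nullstellensatz` (effective Nullstellensatz; sibling of
`EffectiveNullstellensatz.lean`, which proves a Jelonek–Perron single-exponential bound
`deg ≤ (d+1)(N+2)(2(d+1)(N+2))^{N+1}`). This file records, as a NAMED FACT (`def … : Prop`,
D-0014), the ANALYTIC half of W. D. Brownawell's effective Nullstellensatz (Ann. of Math. 126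
(1987) 577–591), with the Łojasiewicz exponent kept as a parameter:

> Let `g_i ∈ ℂ[z_1, …, z_N]` (`i ∈ s`, finitely many) have total degree `≤ D` and satisfy a
> Łojasiewicz inequality at infinity with exponent `E`:
> `∑_{i ∈ s} |g_i(a)|² ≥ ε · (1 + |a|²)^{-E}` for all `a ∈ ℂ^N`, for some `ε > 0`.
> Then `1 = ∑ h_i g_i` with polynomials `h_i` such that `deg (h_i g_i) ≤ (N+1)(E+D)`.

In words: the degree of a Bezout (Nullstellensatz) identity is LINEAR in the number of variables,
the degree of the generators and the Łojasiewicz exponent at infinity — in contrast with the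
purely algebraic bounds `d^N` (Brownawell, Kollár 1988, Jelonek 2005), which are what one gets
when `E` itself is bounded by elimination theory (`E ≤ d^{min(N,p)}`, Brownawell 1987 §§2–3,
Ji–Kollár–Shiffman 1992).

## Proof in print (why the statement is a theorem)

Skoda's `L²` division theorem (Skoda 1972, **Théorème 1**, p. 555: `Ω ⊆ ℂ^n` pseudoconvex, `φ`
plurisubharmonic, `g_1, …, g_p` holomorphic, `α > 1`, `q = min(n, p-1)`; if
`∫_Ω |f|² |g|^{-2αq-2} e^{-φ} dλ < ∞` then `f = ∑ g_i h_i` with `h_i` holomorphic and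
`∫_Ω |h|² |g|^{-2αq} e^{-φ} dλ ≤ α/(α-1) · ∫_Ω |f|² |g|^{-2αq-2} e^{-φ} dλ`), applied on
`Ω = ℂ^N` with `f = 1` and the weight `φ = K log(1+|z|²)`, `K = E(αq+1) + N + η` (`η > 0`): the
Łojasiewicz inequality `|g|² ≥ ε(1+|z|²)^{-E}` makes the hypothesis integral converge; the
conclusion and the trivial upper bound `|g|² ≤ C(1+|z|²)^D` give entire functions `h_i` with
`∫ |h_i|² (1+|z|²)^{-K-Dαq} dλ < ∞`, hence (Cauchy estimates / orthogonality of monomials: an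
entire function on `ℂ^N` square-integrable against `(1+|z|²)^{-M}` is a polynomial of degree
`< M - N`) polynomials of degree `< E(αq+1) + Dαq + η`; letting `α ↓ 1`, `η ↓ 0` (degrees are
integers) gives `deg h_i ≤ E(q+1) + Dq`, so `deg (h_i g_i) ≤ (q+1)(E+D) ≤ (N+1)(E+D)`. This is
exactly the "Skoda step" of Brownawell's proof (Brownawell 1987, §1 and the proof of the main
theorem), where the exponent `E` is then supplied by his Chow-form Łojasiewicz inequality; Skoda
1972 Corollaire 1 (p. 561) is the same specialisation for a general weight `φ` with two-sided
bounds `e^{-Cφ} ≲ |g| ≲ e^{Cφ}`. The parametric corollary displayed above is not printed verbatim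
in either source; its derivation from Théorème 1 is the ten lines just given.

## Why it is here

Route ValiantsHypothesis/RefutationDegree, crux `CertWindowQP` (line `skoda-border-sandwich`):
off the border of the determinantal orbit closure the fibre system
"`per_n = det(A₀ + ∑ x_e A_e)`" has Łojasiewicz exponent `0` at infinity, and this fact turns that
into Nullstellensatz refutations of degree polynomial in the matrix size. Formalising Skoda's
theorem needs Hörmander's `L²` theory for `∂̄`, which Mathlib does not have (Lean-XL); hence a
named fact, stated in the vocabulary of `Literature.Computability.Complexity.HasNSRefutationOfDegree`.

## References

* H. Skoda, *Application des techniques L² à la théorie des idéaux d'une algèbre de fonctions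
  holomorphes avec poids*, Ann. Sci. École Norm. Sup. (4) 5 (1972), 545–579, Théorème 1 and
  Corollaire 1. [Skoda1972]
* W. D. Brownawell, *Bounds for the degrees in the Nullstellensatz*, Ann. of Math. (2) 126 (1987),
  577–591. [BrownawellNullstellensatz1987]
* S. Ji, J. Kollár, B. Shiffman, *A global Łojasiewicz inequality for algebraic varieties*,
  Trans. AMS 329 (1992) (the converse direction: degree bounds ⇒ Łojasiewicz). [JiKollarShiffman1992]
* J. Kollár, *Sharp effective Nullstellensatz*, J. AMS 1 (1988). [Kollar1988]
-/

noncomputable section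

open MvPolynomial
open scoped BigOperators

namespace Literature.RingTheory.Nullstellensatz

/-- **Skoda–Brownawell degree bound** (named fact; the analytic half of Brownawell's effective
Nullstellensatz, Łojasiewicz exponent kept as a parameter). For finitely many polynomials
`g_i ∈ ℂ[σ]`, `i ∈ s`, of total degree `≤ D` on `ℂ^N` (`N = #σ`) satisfying the Łojasiewicz
inequality at infinity `∑_{i∈s} |g_i(a)|² ≥ ε (1+|a|²)^{-E}` (`ε > 0`, all `a`), there is a
Nullstellensatz identity `∑ h_i g_i = 1` with every product of total degree `≤ (N+1)(E+D)`
(`HasNSRefutationOfDegree`, Krajíček's degree convention). Derivation: Skoda 1972 Théorème 1 on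
`ℂ^N` with `f = 1`, weight `K log(1+|z|²)`, then Cauchy estimates (module docstring); the
instance `E ≍ D^{min(N,p)}` is Brownawell's theorem. Trivially true for `N = 0` (constants) and
vacuous for `s = ∅`. [cite: Skoda1972, Théorème 1 (p. 555) and Corollaire 1 (p. 561)] -/
def skodaBrownawellDegreeBound {σ ι : Type*} [Fintype σ] : Prop :=
  ∀ (s : Finset ι) (g : ι → MvPolynomial σ ℂ) (D E : ℕ),
    (∀ i ∈ s, (g i).totalDegree ≤ D) →
    (∃ ε : ℝ, 0 < ε ∧ ∀ a : σ → ℂ,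
        ε * (1 + ∑ v, ‖a v‖ ^ 2) ^ (-(E : ℝ)) ≤ ∑ i ∈ s, ‖MvPolynomial.eval a (g i)‖ ^ 2) →
    Literature.Computability.Complexity.HasNSRefutationOfDegree g ((Fintype.card σ + 1) * (E + D))

/-- Sanity check of the shape of `skodaBrownawellDegreeBound` (not a discharge): in dimension
`N = 0` (no variables) every polynomial is a constant, the Łojasiewicz hypothesis says some
`g_i` is a nonzero constant, and `h_i = g_i⁻¹` is a degree-`0` Nullstellensatz identity.
[folklore] -/
theorem skodaBrownawellDegreeBound_of_isEmpty {σ ι : Type*} [Fintype σ] [IsEmpty σ] :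
    skodaBrownawellDegreeBound (σ := σ) (ι := ι) := by
  classical
  intro s g D E _ hloj
  obtain ⟨ε, hε, hε'⟩ := hloj
  -- at the unique point of `ℂ^0` some `g_i` does not vanish
  have hpt := hε' isEmptyElim
  have hpos : (0 : ℝ) < ε * (1 + ∑ v, ‖(isEmptyElim : σ → ℂ) v‖ ^ 2) ^ (-(E : ℝ)) :=
    mul_pos hε (Real.rpow_pos_of_pos
      (add_pos_of_pos_of_nonneg one_pos (Finset.sum_nonneg fun v _ => by positivity)) _)
  have hsum : (0 : ℝ) < ∑ i ∈ s, ‖MvPolynomial.eval (isEmptyElim : σ → ℂ) (g i)‖ ^ 2 :=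
    lt_of_lt_of_le hpos hpt
  obtain ⟨i, hi, hgi⟩ : ∃ i ∈ s, (0 : ℝ) < ‖MvPolynomial.eval (isEmptyElim : σ → ℂ) (g i)‖ ^ 2 := by
    by_contra hno
    push Not at hno
    exact (lt_irrefl (0 : ℝ)) (lt_of_lt_of_le hsum (Finset.sum_nonpos hno))
  have hne : MvPolynomial.eval (isEmptyElim : σ → ℂ) (g i) ≠ 0 := by
    intro h0
    rw [h0, norm_zero] at hgi
    norm_num at hgi
  -- over `ℂ^0` every polynomial is the constant `g(pt)`
  have hconst : ∀ p : MvPolynomial σ ℂ, p = C (MvPolynomial.eval (isEmptyElim : σ → ℂ) p) := by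
    intro p
    obtain ⟨c, rfl⟩ := (C_surjective σ : Function.Surjective (C : ℂ → MvPolynomial σ ℂ)) p
    rw [eval_C]
  refine ⟨{i}, fun j => C (MvPolynomial.eval (isEmptyElim : σ → ℂ) (g j))⁻¹, ?_, ?_⟩
  · rw [Finset.sum_singleton]
    conv_lhs => rw [hconst (g i)]
    rw [← C_mul, inv_mul_cancel₀ hne, C_1]
  · intro j _
    rw [hconst (g j), ← C_mul, totalDegree_C]
    exact Nat.zero_le _

end Literature.RingTheory.Nullstellensatz

end
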